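import Mathlib.Analysis.SpecialFunctions.Pow.Real
import Literature.Computability.QuantumComplexity.MatchgateCliffordAlgebra
import HarnessLib

/-!
# Dyadic evaluation of the matchgate simulation formula: error analysis and list layout

Topic `Literature/Computability/QuantumComplexity`, model namespace `Matchgate`. Proof
infrastructure, part III, of the discharge of `JozsaMiyake2008_thm1` (`MatchgateSimulation.lean`;
parts I–II: `MatchgateCliffordAlgebra.lean`, `MatchgateHeisenberg.lean`). Jozsa–Miyake's proof of
Theorem 1 ends with "the full matrix `R` is poly-time computable … hence `⟨Z_k⟩_out` is poly-time
computable" (§4, after eq. (8) and (10)); with real gate entries this means: multiply DYADIC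
APPROXIMATIONS of the `SO(4)` blocks and control the error. This file is that (implicit in print)
numerical analysis, on abstract data so that it imports only part I:

* `exactFold v ts` / `approxFold v ts` — the row vector `v · E_T ⋯ E_1` for a list of abstract
  steps `ts : List (ℕ × R × R̃)` (block position, exact block, approximate block), and the
  Euclidean bookkeeping `vnorm` (Cauchy–Schwarz, triangle inequality, isometry of orthogonal
  steps, `vnorm_vecMul_embD_le` : a block perturbation of entrywise size `η` moves a vector by
  at most `4η‖v‖`);
* **`vnorm_approxFold_sub_exactFold_le`**: with unit start vector, orthogonal exact blocks and
  `η`-accurate approximate blocks, `‖ṽ_T - v_T‖ ≤ 8ηT` as long as `8ηT ≤ 1`;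
* **`abs_zExp_sub_zExp_le`**: the bilinear read-out `zExp` (JM08 eq. (10)) is `3δ`-stable;
* `abs_roundEst_le` : rounding `2^k (1 - Z̃)/2` to an integer gives a `2^{-k}`-approximation of
  `p₁ = (1 - Z)/2` once `|Z̃ - Z| ≤ 2^{-(k+1)}`;
* the LIST LAYOUT used by the machine of part IV: `Represents l v` (`l[2i + b] = v (i, b)`),
  `stepL` (four `List.set`s = one sparse row update, `Represents.stepL`), `unitL`, `zExpL`.

## References

* R. Jozsa, A. Miyake, *Matchgates and classical simulation of quantum circuits*, Proc. R. Soc. A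
  464 (2008) 3089–3106, §4 (eq. (8), (10): "the full matrix is poly-time computable").
  [JozsaMiyake2008]
* N. J. Higham, *Accuracy and Stability of Numerical Algorithms*, 2nd ed., SIAM 2002, §3.1 and
  Lemma 3.5 / §19 (forward error of products with orthogonal factors grows linearly). [folklore]
-/

namespace Literature.Computability.QuantumComplexity.Matchgate

open Matrix Finset Literature.Computability.Cryptography

variable {N : ℕ}

/-! ### Euclidean bookkeeping on `MIdx N → ℝ` -/

/-- The Euclidean norm of a real row vector. [folklore] -/
noncomputable def vnorm {ι : Type*} [Fintype ι] (v : ι → ℝ) : ℝ := Real.sqrt (v ⬝ᵥ v)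

section vnorm

variable {ι : Type*} [Fintype ι]

/-- `v · v = ∑ vᵢ²  ≥ 0`. [folklore] -/
theorem dotProduct_self_eq_sum_sq (v : ι → ℝ) : v ⬝ᵥ v = ∑ i, v i ^ 2 :=
  sum_congr rfl fun i _ => by ring

/-- `0 ≤ v · v`. [folklore] -/
theorem dotProduct_self_nonneg (v : ι → ℝ) : 0 ≤ v ⬝ᵥ v := by
  rw [dotProduct_self_eq_sum_sq]; exact sum_nonneg fun i _ => sq_nonneg _

/-- `0 ≤ ‖v‖`. [folklore] -/
theorem vnorm_nonneg (v : ι → ℝ) : 0 ≤ vnorm v := Real.sqrt_nonneg _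

/-- `‖v‖² = v · v`. [folklore] -/
theorem vnorm_sq (v : ι → ℝ) : vnorm v ^ 2 = v ⬝ᵥ v := Real.sq_sqrt (dotProduct_self_nonneg v)

/-- **Cauchy–Schwarz**: `|v · w| ≤ ‖v‖ ‖w‖`. [folklore] -/
theorem abs_dotProduct_le (v w : ι → ℝ) : |v ⬝ᵥ w| ≤ vnorm v * vnorm w := by
  rw [vnorm, vnorm, ← Real.sqrt_mul (dotProduct_self_nonneg v)]
  apply Real.abs_le_sqrt
  rw [dotProduct_self_eq_sum_sq, dotProduct_self_eq_sum_sq]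
  exact sum_mul_sq_le_sq_mul_sq univ v w

/-- Entries are bounded by the norm. [folklore] -/
theorem abs_apply_le_vnorm (v : ι → ℝ) (i : ι) : |v i| ≤ vnorm v := by
  apply Real.abs_le_sqrt
  rw [dotProduct_self_eq_sum_sq]
  exact single_le_sum (f := fun j => v j ^ 2) (fun j _ => sq_nonneg _) (mem_univ i)

/-- **Triangle inequality.** [folklore] -/
theorem vnorm_add_le (v w : ι → ℝ) : vnorm (v + w) ≤ vnorm v + vnorm w := by
  have h : (v + w) ⬝ᵥ (v + w) ≤ (vnorm v + vnorm w) ^ 2 := by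
    rw [add_dotProduct, dotProduct_add, dotProduct_add, dotProduct_comm w v, add_sq, vnorm_sq, vnorm_sq]
    have := (abs_le.1 (abs_dotProduct_le v w)).2
    linarith
  calc vnorm (v + w) = Real.sqrt ((v + w) ⬝ᵥ (v + w)) := rfl
    _ ≤ Real.sqrt ((vnorm v + vnorm w) ^ 2) := Real.sqrt_le_sqrt h
    _ = vnorm v + vnorm w := Real.sqrt_sq (add_nonneg (vnorm_nonneg v) (vnorm_nonneg w))

/-- `‖-v‖ = ‖v‖`. [folklore] -/
theorem vnorm_neg (v : ι → ℝ) : vnorm (-v) = vnorm v := by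
  rw [vnorm, vnorm, neg_dotProduct, dotProduct_neg, neg_neg]

/-- `‖v - w‖ = ‖w - v‖`. [folklore] -/
theorem vnorm_sub_comm (v w : ι → ℝ) : vnorm (v - w) = vnorm (w - v) := by
  rw [← vnorm_neg, neg_sub]

/-- `‖v‖ ≤ ‖w‖ + ‖v - w‖`. [folklore] -/
theorem vnorm_le_vnorm_add_vnorm_sub (v w : ι → ℝ) : vnorm v ≤ vnorm w + vnorm (v - w) := by
  have := vnorm_add_le w (v - w); rwa [add_sub_cancel] at this

/-- **Orthogonal steps are isometries**: `‖v E‖ = ‖v‖` for `E Eᵀ = 1`. [folklore] -/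
theorem vnorm_vecMul_of_mul_transpose [DecidableEq ι] {E : Matrix ι ι ℝ} (hE : E * Eᵀ = 1) (v : ι → ℝ) :
    vnorm (v ᵥ* E) = vnorm v := by
  have key : ∀ v w : ι → ℝ, (v ᵥ* E) ⬝ᵥ (w ᵥ* E) = v ⬝ᵥ w := fun v w => by
    rw [← mulVec_transpose E w, dotProduct_mulVec, vecMul_vecMul, hE, vecMul_one]
  rw [vnorm, vnorm, key]

/-- The norm of the entrywise absolute value. [folklore] -/
theorem vnorm_abs (v : ι → ℝ) : vnorm (fun i => |v i|) = vnorm v := by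
  rw [vnorm, vnorm, dotProduct_self_eq_sum_sq, dotProduct_self_eq_sum_sq]
  simp only [sq_abs]

/-- The norm is invariant under re-indexing along an equivalence. [folklore] -/
theorem vnorm_comp_equiv (e : ι ≃ ι) (v : ι → ℝ) : vnorm (v ∘ e) = vnorm v := by
  rw [vnorm, vnorm, dotProduct_self_eq_sum_sq, dotProduct_self_eq_sum_sq]
  congr 1
  exact e.sum_comp (fun i => v i ^ 2)

/-- Unit vectors. [folklore] -/
theorem vnorm_eq_one_of_dotProduct {v : ι → ℝ} (h : v ⬝ᵥ v = 1) : vnorm v = 1 := by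
  rw [vnorm, h, Real.sqrt_one]

end vnorm

/-! ### Block perturbations -/

/-- The block embedding of a `4 × 4` matrix with ZERO off the block (the difference of two `embE`s).
[folklore] -/
def embD (j : ℕ) (D : Matrix LIdx LIdx ℝ) : Matrix (MIdx N) (MIdx N) ℝ :=
  Matrix.of fun p q => if InBlock j p.1 ∧ InBlock j q.1 then D (locOf j p) (locOf j q) else 0

/-- `embE A - embE B = embD (A - B)`. [folklore] -/
theorem embE_sub_embE (j : ℕ) (A B : Matrix LIdx LIdx ℝ) :
    (embE j A - embE j B : Matrix (MIdx N) (MIdx N) ℝ) = embD j (A - B) := by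
  ext p q
  simp only [embE, embD, Matrix.sub_apply, of_apply]
  split_ifs <;> simp

/-- The sparse row update of a zero-padded block. [folklore] -/
theorem vecMul_embD_apply (j : ℕ) (h : j + 2 ≤ N) (D : Matrix LIdx LIdx ℝ) (w : MIdx N → ℝ) (q : MIdx N) :
    (w ᵥ* embD j D) q = if InBlock j q.1 then ∑ μ : LIdx, w (blockIdx j h μ) * D μ (locOf j q) else 0 := by
  rw [vecMul, dotProduct]
  split_ifs with hq
  · rw [sum_mIdx_split j h, sum_eq_zero (s := univ.filter _), add_zero]
    · refine sum_congr rfl fun μ _ => ?_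
      simp [embD, inBlock_blockEmb, hq]
    · intro p hp
      rw [mem_filter] at hp
      simp [embD, hp.2]
  · exact sum_eq_zero fun p _ => by simp [embD, hq]

/-- A partial sum of squares over the block is at most `v · v`. [folklore] -/
theorem sum_block_sq_le (j : ℕ) (h : j + 2 ≤ N) (w : MIdx N → ℝ) :
    ∑ μ : LIdx, w (blockIdx j h μ) ^ 2 ≤ w ⬝ᵥ w := by
  rw [dotProduct_self_eq_sum_sq, sum_mIdx_split j h]
  exact le_add_of_nonneg_right (sum_nonneg fun p _ => sq_nonneg _)

/-- **A block perturbation of entrywise size `η` moves a vector by at most `4η‖w‖`.**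
[folklore] -/
theorem vnorm_vecMul_embD_le (j : ℕ) (h : j + 2 ≤ N) {D : Matrix LIdx LIdx ℝ} {η : ℝ} (hη : 0 ≤ η)
    (hD : ∀ μ ν, |D μ ν| ≤ η) (w : MIdx N → ℝ) : vnorm (w ᵥ* embD j D) ≤ 4 * η * vnorm w := by
  have hsq : (w ᵥ* embD j D) ⬝ᵥ (w ᵥ* embD j D) ≤ (4 * η * vnorm w) ^ 2 := by
    rw [dotProduct_self_eq_sum_sq, sum_mIdx_split j h, sum_eq_zero (s := univ.filter _), add_zero]
    · have hν : ∀ ν : LIdx, (w ᵥ* embD j D) (blockIdx j h ν) ^ 2 ≤ (w ⬝ᵥ w) * (4 * η ^ 2) := by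
        intro ν
        rw [vecMul_embD_apply j h, blockIdx_fst, if_pos (inBlock_blockEmb j h ν.1), locOf_blockIdx]
        calc (∑ μ : LIdx, w (blockIdx j h μ) * D μ ν) ^ 2
            ≤ (∑ μ : LIdx, w (blockIdx j h μ) ^ 2) * ∑ μ : LIdx, D μ ν ^ 2 := sum_mul_sq_le_sq_mul_sq univ _ _
          _ ≤ (w ⬝ᵥ w) * (4 * η ^ 2) := by
            refine mul_le_mul (sum_block_sq_le j h w) ?_ (sum_nonneg fun μ _ => sq_nonneg _) (dotProduct_self_nonneg w)
            calc ∑ μ : LIdx, D μ ν ^ 2 ≤ ∑ _μ : LIdx, η ^ 2 :=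
                  sum_le_sum fun μ _ => by rw [← sq_abs]; exact pow_le_pow_left₀ (abs_nonneg _) (hD μ ν) 2
              _ = 4 * η ^ 2 := by rw [sum_const, card_univ]; simp
      calc ∑ ν : LIdx, (w ᵥ* embD j D) (blockIdx j h ν) ^ 2 ≤ ∑ _ν : LIdx, (w ⬝ᵥ w) * (4 * η ^ 2) :=
            sum_le_sum fun ν _ => hν ν
        _ = (4 * η * vnorm w) ^ 2 := by rw [sum_const, card_univ, mul_pow, vnorm_sq]; simp; ring
    · intro p hp
      rw [mem_filter] at hp
      simp [vecMul_embD_apply j h, hp.2]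
  calc vnorm (w ᵥ* embD j D) = Real.sqrt ((w ᵥ* embD j D) ⬝ᵥ (w ᵥ* embD j D)) := rfl
    _ ≤ Real.sqrt ((4 * η * vnorm w) ^ 2) := Real.sqrt_le_sqrt hsq
    _ = 4 * η * vnorm w := Real.sqrt_sq (by have := vnorm_nonneg w; positivity)

/-! ### Exact and approximate row folds -/

/-- An abstract step of the row recursion: block position, exact block, approximate block. [folklore] -/
abbrev AStep : Type := ℕ × Matrix LIdx LIdx ℝ × Matrix LIdx LIdx ℝ

/-- **The exact row fold** `v · E_T ⋯ E_1` (last step outermost, as in `rowVec`). [cite: JozsaMiyake2008, §4 eq. (8)] -/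
noncomputable def exactFold (v : MIdx N → ℝ) (ts : List AStep) : MIdx N → ℝ :=
  ts.foldr (fun t w => w ᵥ* embE t.1 t.2.1) v

/-- **The approximate row fold** with the approximate blocks. [cite: JozsaMiyake2008, §4 eq. (8)] -/
noncomputable def approxFold (v : MIdx N → ℝ) (ts : List AStep) : MIdx N → ℝ :=
  ts.foldr (fun t w => w ᵥ* embE t.1 t.2.2) v

/-- Unfolding one exact step. [folklore] -/
@[simp] theorem exactFold_cons (v : MIdx N → ℝ) (t : AStep) (ts : List AStep) :
    exactFold v (t :: ts) = exactFold v ts ᵥ* embE t.1 t.2.1 := rfl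

/-- Unfolding one approximate step. [folklore] -/
@[simp] theorem approxFold_cons (v : MIdx N → ℝ) (t : AStep) (ts : List AStep) :
    approxFold v (t :: ts) = approxFold v ts ᵥ* embE t.1 t.2.2 := rfl

/-- The empty folds. [folklore] -/
@[simp] theorem exactFold_nil (v : MIdx N → ℝ) : exactFold v [] = v := rfl

/-- The empty folds. [folklore] -/
@[simp] theorem approxFold_nil (v : MIdx N → ℝ) : approxFold v [] = v := rfl

/-- The hypotheses on the steps: blocks fit, exact blocks are orthogonal, approximate blocks are
`η`-close entrywise. [folklore] -/
def GoodSteps (N : ℕ) (η : ℝ) (ts : List AStep) : Prop :=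
  ∀ t ∈ ts, t.1 + 2 ≤ N ∧ t.2.1 * t.2.1ᵀ = 1 ∧ ∀ μ ν, |t.2.2 μ ν - t.2.1 μ ν| ≤ η

/-- `GoodSteps` of a tail. [folklore] -/
theorem GoodSteps.tail {η : ℝ} {t : AStep} {ts : List AStep} (h : GoodSteps N η (t :: ts)) : GoodSteps N η ts :=
  fun t' ht' => h t' (List.mem_cons_of_mem t ht')

/-- **Exact folds are isometries.** [cite: JozsaMiyake2008, Thm 3 (R ∈ SO(2n))] -/
theorem vnorm_exactFold {η : ℝ} {ts : List AStep} (h : GoodSteps N η ts) (v : MIdx N → ℝ) :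
    vnorm (exactFold v ts) = vnorm v := by
  induction ts with
  | nil => rfl
  | cons t ts ih =>
    rw [exactFold_cons, vnorm_vecMul_of_mul_transpose (embE_mul_transpose _ (h t List.mem_cons_self).1
      (h t List.mem_cons_self).2.1), ih h.tail]

/-- **Forward error of the approximate row fold**: with a unit start vector, after `T` steps with
`η`-accurate blocks the error is at most `8ηT`, provided `8ηT ≤ 1` (the error recursion is
`δ' ≤ δ + 4η(1 + δ)`). [folklore] -/
theorem vnorm_approxFold_sub_exactFold_le {η : ℝ} (hη : 0 ≤ η) {v : MIdx N → ℝ} (hv : vnorm v = 1) :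
    ∀ {ts : List AStep}, GoodSteps N η ts → 8 * η * ts.length ≤ 1 →
      vnorm (approxFold v ts - exactFold v ts) ≤ 8 * η * ts.length
  | [], _, _ => by simp [vnorm]
  | t :: ts, h, hlen => by
    obtain ⟨hj, hR, hclose⟩ := h t List.mem_cons_self
    have hlen' : 8 * η * ts.length ≤ 1 := by
      refine le_trans ?_ hlen
      have : (ts.length : ℝ) ≤ (t :: ts).length := by exact_mod_cast Nat.le_succ _
      nlinarith
    have ih := vnorm_approxFold_sub_exactFold_le hη hv h.tail hlen'
    set a := exactFold v ts
    set b := approxFold v ts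
    have hsplit : b ᵥ* embE t.1 t.2.2 - a ᵥ* embE t.1 t.2.1 =
        (b - a) ᵥ* embE t.1 t.2.1 + b ᵥ* embD t.1 (t.2.2 - t.2.1) := by
      rw [← embE_sub_embE, vecMul_sub, sub_vecMul]; abel
    have ha : vnorm a = 1 := by rw [vnorm_exactFold h.tail, hv]
    have hb : vnorm b ≤ 1 + vnorm (b - a) := by have := vnorm_le_vnorm_add_vnorm_sub b a; linarith
    have hδ1 : vnorm (b - a) ≤ 1 := ih.trans hlen'
    rw [approxFold_cons, exactFold_cons, hsplit, List.length_cons, Nat.cast_succ]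
    calc vnorm ((b - a) ᵥ* embE t.1 t.2.1 + b ᵥ* embD t.1 (t.2.2 - t.2.1))
        ≤ vnorm ((b - a) ᵥ* embE t.1 t.2.1) + vnorm (b ᵥ* embD t.1 (t.2.2 - t.2.1)) := vnorm_add_le _ _
      _ ≤ vnorm (b - a) + 4 * η * vnorm b := by
          rw [vnorm_vecMul_of_mul_transpose (embE_mul_transpose _ hj hR)]
          exact add_le_add le_rfl
            (vnorm_vecMul_embD_le (D := t.2.2 - t.2.1) t.1 hj hη (fun μ ν => by rw [Matrix.sub_apply]; exact hclose μ ν) b)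
      _ ≤ vnorm (b - a) + 4 * η * (1 + 1) := by nlinarith [vnorm_nonneg (b - a)]
      _ ≤ 8 * η * (ts.length + 1) := by nlinarith

/-! ### Stability of the read-out `zExp` -/

/-- The index involution exchanging the two Majorana types of each wire. [folklore] -/
def swapType : MIdx N ≃ MIdx N where
  toFun q := (q.1, !q.2)
  invFun q := (q.1, !q.2)
  left_inv q := by simp
  right_inv q := by simp

/-- A mixed sum over the two types of each wire is bounded by the norms (Cauchy–Schwarz after
pairing `(i, b)` with `(i, ¬b)`). [folklore] -/
theorem sum_mul_swap_le (f g : MIdx N → ℝ) :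
    ∑ i : Fin N, (|f (i, false)| * |g (i, true)| + |f (i, true)| * |g (i, false)|) ≤ vnorm f * vnorm g := by
  have h1 : ∑ i : Fin N, (|f (i, false)| * |g (i, true)| + |f (i, true)| * |g (i, false)|) =
      (fun q => |f q|) ⬝ᵥ (fun q => |g (swapType q)|) := by
    rw [dotProduct, Fintype.sum_prod_type]
    refine sum_congr rfl fun i _ => ?_
    rw [Fintype.sum_bool, add_comm]; rfl
  rw [h1]
  refine (le_abs_self _).trans ((abs_dotProduct_le _ _).trans ?_)
  rw [vnorm_abs, show (fun q => |g (swapType q)|) = (fun q => |g q|) ∘ swapType from rfl, vnorm_comp_equiv,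
    vnorm_abs]

/-- **The read-out is stable**: `|zExp x ṽ₀ ṽ₁ - zExp x v₀ v₁| ≤ ‖ṽ₀ - v₀‖ ‖ṽ₁‖ + ‖v₀‖ ‖ṽ₁ - v₁‖`.
[cite: JozsaMiyake2008, §4 eq. (10)] -/
theorem abs_zExp_sub_zExp_le (x : QReg N) (v₀ v₁ w₀ w₁ : MIdx N → ℝ) :
    |zExp x w₀ w₁ - zExp x v₀ v₁| ≤ vnorm (w₀ - v₀) * vnorm w₁ + vnorm v₀ * vnorm (w₁ - v₁) := by
  unfold zExp
  rw [← sum_sub_distrib]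
  refine (abs_sum_le_sum_abs _ _).trans ?_
  have key : ∀ i : Fin N, |(if x i then -1 else 1 : ℝ) * (w₀ (i, false) * w₁ (i, true) - w₀ (i, true) * w₁ (i, false)) -
      (if x i then -1 else 1 : ℝ) * (v₀ (i, false) * v₁ (i, true) - v₀ (i, true) * v₁ (i, false))| ≤
      (|(w₀ - v₀) (i, false)| * |w₁ (i, true)| + |(w₀ - v₀) (i, true)| * |w₁ (i, false)|) +
      (|v₀ (i, false)| * |(w₁ - v₁) (i, true)| + |v₀ (i, true)| * |(w₁ - v₁) (i, false)|) := by
    intro i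
    have hs : |(if x i then -1 else 1 : ℝ)| = 1 := by split_ifs <;> simp
    rw [← mul_sub, abs_mul, hs, one_mul]
    simp only [Pi.sub_apply]
    have e : w₀ (i, false) * w₁ (i, true) - w₀ (i, true) * w₁ (i, false) -
        (v₀ (i, false) * v₁ (i, true) - v₀ (i, true) * v₁ (i, false)) =
        ((w₀ (i, false) - v₀ (i, false)) * w₁ (i, true) + v₀ (i, false) * (w₁ (i, true) - v₁ (i, true))) -
        ((w₀ (i, true) - v₀ (i, true)) * w₁ (i, false) + v₀ (i, true) * (w₁ (i, false) - v₁ (i, false))) := by ring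
    rw [e]
    refine (abs_sub _ _).trans ?_
    refine (add_le_add (abs_add_le _ _) (abs_add_le _ _)).trans ?_
    simp only [abs_mul]
    linarith
  refine (sum_le_sum fun i _ => key i).trans ?_
  rw [sum_add_distrib]
  exact add_le_add (sum_mul_swap_le _ _) (by
    have := sum_mul_swap_le (w₁ - v₁) v₀
    rw [mul_comm] at this
    refine le_trans (le_of_eq ?_) this
    exact sum_congr rfl fun i _ => by ring)

/-- **Read-out error in the simulation regime**: unit exact rows and `δ`-accurate approximate rows
with `δ ≤ 1` give `|Z̃ - Z| ≤ 3δ`. [cite: JozsaMiyake2008, §4 eq. (10)] -/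
theorem abs_zExp_sub_zExp_le' (x : QReg N) {v₀ v₁ w₀ w₁ : MIdx N → ℝ} {δ : ℝ} (h₀ : vnorm v₀ = 1)
    (h₁ : vnorm v₁ = 1) (hw₀ : vnorm (w₀ - v₀) ≤ δ) (hw₁ : vnorm (w₁ - v₁) ≤ δ) (hδ : δ ≤ 1) :
    |zExp x w₀ w₁ - zExp x v₀ v₁| ≤ 3 * δ := by
  have hδ0 : 0 ≤ δ := (vnorm_nonneg _).trans hw₀
  have hw₁' : vnorm w₁ ≤ 1 + δ := by
    have := vnorm_le_vnorm_add_vnorm_sub w₁ v₁; linarith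
  calc |zExp x w₀ w₁ - zExp x v₀ v₁| ≤ vnorm (w₀ - v₀) * vnorm w₁ + vnorm v₀ * vnorm (w₁ - v₁) :=
        abs_zExp_sub_zExp_le x v₀ v₁ w₀ w₁
    _ ≤ δ * (1 + δ) + 1 * δ := by
        refine add_le_add (mul_le_mul hw₀ hw₁' (vnorm_nonneg _) hδ0) ?_
        rw [h₀]; exact mul_le_mul_of_nonneg_left hw₁ zero_le_one
    _ ≤ 3 * δ := by nlinarith

/-! ### Rounding the estimate -/

/-- **The integer estimate** `round (2^k (1 - Z̃)/2)` of `2^k p₁`. [cite: JozsaMiyake2008, Thm 1 ("compute p₀ - p₁ … to m digits")] -/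
def roundEst (k : ℕ) (z : ℚ) : ℤ := round (2 ^ k * ((1 - z) / 2))

/-- **The rounded estimate is a `2^{-k}`-approximation of `p₁ = (1 - Z)/2`** whenever
`|Z̃ - Z| ≤ 2^{-(k+1)}`. [cite: JozsaMiyake2008, Thm 1] -/
theorem abs_roundEst_le (k : ℕ) {z : ℚ} {Z p : ℝ} (hp : p = (1 - Z) / 2) (hz : |(z : ℝ) - Z| ≤ (1 / 2) ^ (k + 1)) :
    |(roundEst k z : ℝ) / 2 ^ k - p| ≤ (1 / 2) ^ k := by
  have h2k : (0 : ℝ) < 2 ^ k := by positivity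
  have hround : |(2 : ℝ) ^ k * ((1 - (z : ℝ)) / 2) - (roundEst k z : ℝ)| ≤ 1 / 2 := by
    rw [roundEst]
    have h' := (Rat.cast_le (K := ℝ)).2 (abs_sub_round ((2 : ℚ) ^ k * ((1 - z) / 2)))
    push_cast at h'
    exact h'
  have h1 : |(roundEst k z : ℝ) / 2 ^ k - (1 - (z : ℝ)) / 2| ≤ (1 / 2) ^ k / 2 := by
    rw [show (roundEst k z : ℝ) / 2 ^ k - (1 - (z : ℝ)) / 2 =
        -((2 : ℝ) ^ k * ((1 - (z : ℝ)) / 2) - (roundEst k z : ℝ)) / 2 ^ k by field_simp; ring,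
      abs_div, abs_neg, abs_of_pos h2k, div_le_iff₀ h2k]
    refine hround.trans (le_of_eq ?_)
    rw [one_div_pow, div_mul_eq_mul_div, one_div_mul_cancel (ne_of_gt h2k)]
  have h2 : |(1 - (z : ℝ)) / 2 - p| ≤ (1 / 2) ^ (k + 1) / 2 := by
    rw [hp, show (1 - (z : ℝ)) / 2 - (1 - Z) / 2 = -(((z : ℝ) - Z) / 2) by ring, abs_neg, abs_div,
      abs_of_pos (by norm_num : (0 : ℝ) < 2)]
    exact div_le_div_of_nonneg_right hz (by norm_num)
  calc |(roundEst k z : ℝ) / 2 ^ k - p|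
      ≤ |(roundEst k z : ℝ) / 2 ^ k - (1 - (z : ℝ)) / 2| + |(1 - (z : ℝ)) / 2 - p| := abs_sub_le _ _ _
    _ ≤ (1 / 2) ^ k / 2 + (1 / 2) ^ (k + 1) / 2 := add_le_add h1 h2
    _ ≤ (1 / 2) ^ k := by rw [pow_succ]; nlinarith [pow_pos (by norm_num : (0 : ℝ) < 1 / 2) k]

/-! ### The list layout of row vectors -/

section layout

variable {K : Type*}

/-- **A list lays out a row vector**: `l[2i + b] = v (i, b)` (`b = 0` for type `X`, `1` for `Y`),
`|l| = 2N`. [folklore] -/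
def Represents [Zero K] (l : List K) (v : MIdx N → K) : Prop :=
  l.length = 2 * N ∧ ∀ (i : Fin N) (b : Bool), l.getD (2 * i + b.toNat) 0 = v (i, b)

/-- Reading one entry of a laid-out vector after an update. [folklore] -/
theorem getD_set_eq (l : List K) {i : ℕ} (a d : K) (hi : i < l.length) (k : ℕ) :
    (l.set i a).getD k d = if k = i then a else l.getD k d := by
  simp only [List.getD_eq_getElem?_getD, List.getElem?_set]
  by_cases h : i = k
  · subst h; simp [hi]
  · rw [if_neg h, if_neg (Ne.symm h)]

/-- Reading the four entries of the block at `j`: `μ ↦ l[2(j + μ₁) + μ₂]`. [folklore] -/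
def readBlock [Zero K] (j : ℕ) (l : List K) (μ : LIdx) : K := l.getD (2 * (j + μ.1) + μ.2.toNat) 0

/-- The new value of the block entry `ν` after the step: `∑_μ l[block μ] R_{μν}`. [folklore] -/
def newVal [NonAssocSemiring K] (j : ℕ) (R : Matrix LIdx LIdx K) (l : List K) (ν : LIdx) : K :=
  ∑ μ : LIdx, readBlock j l μ * R μ ν

/-- **One sparse row update on the list layout**: overwrite the four block positions
`2j, …, 2j+3` by the new values (all computed from the OLD list). [cite: JozsaMiyake2008, §4 eq. (8)] -/
def stepL [NonAssocSemiring K] (j : ℕ) (R : Matrix LIdx LIdx K) (l : List K) : List K :=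
  ((((l.set (2 * j) (newVal j R l (0, false))).set (2 * j + 1) (newVal j R l (0, true))).set (2 * j + 2)
    (newVal j R l (1, false))).set (2 * j + 3) (newVal j R l (1, true)))

/-- `stepL` preserves the length. [folklore] -/
@[simp] theorem length_stepL [NonAssocSemiring K] (j : ℕ) (R : Matrix LIdx LIdx K) (l : List K) :
    (stepL j R l).length = l.length := by
  simp [stepL]

/-- Reading a laid-out vector in the block. [folklore] -/
theorem Represents.readBlock [Zero K] {l : List K} {v : MIdx N → K} (h : Represents l v) (j : ℕ)
    (hj : j + 2 ≤ N) (μ : LIdx) : readBlock j l μ = v (blockIdx j hj μ) :=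
  h.2 ⟨j + μ.1, by have := μ.1.isLt; omega⟩ μ.2

/-- Entries of `stepL`. [folklore] -/
theorem getD_stepL [NonAssocSemiring K] (j : ℕ) (R : Matrix LIdx LIdx K) (l : List K) (hl : 2 * j + 3 < l.length)
    (k : ℕ) :
    (stepL j R l).getD k 0 =
      if k = 2 * j + 3 then newVal j R l (1, true) else if k = 2 * j + 2 then newVal j R l (1, false)
      else if k = 2 * j + 1 then newVal j R l (0, true) else if k = 2 * j then newVal j R l (0, false)
      else l.getD k 0 := by
  unfold stepL
  rw [getD_set_eq _ _ _ (by simp; omega), getD_set_eq _ _ _ (by simp; omega),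
    getD_set_eq _ _ _ (by simp; omega), getD_set_eq _ _ _ (by omega)]

/-- **The list step lays out the sparse row update** `v ↦ v · embE j R`. [cite: JozsaMiyake2008, §4 eq. (8)] -/
theorem Represents.stepL [NonAssocSemiring K] {l : List K} {v : MIdx N → K} (h : Represents l v) {j : ℕ}
    (hj : j + 2 ≤ N) (R : Matrix LIdx LIdx K) : Represents (stepL j R l) (v ᵥ* embE j R) := by
  refine ⟨by rw [length_stepL, h.1], fun i b => ?_⟩
  have hl : 2 * j + 3 < l.length := by rw [h.1]; omega
  have hnew : ∀ ν : LIdx, newVal j R l ν = ∑ μ : LIdx, v (blockIdx j hj μ) * R μ ν := fun ν =>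
    sum_congr rfl fun μ _ => by rw [h.readBlock j hj]
  rw [getD_stepL j R l hl, vecMul_embE_apply j hj]
  have hb : b.toNat ≤ 1 := Bool.toNat_le b
  by_cases hin : InBlock j i
  · rw [if_pos hin]
    simp only [InBlock] at hin
    split_ifs with h1 h2 h3 h4
    · rw [hnew, show locOf j (i, b) = (1, true) by
        cases b <;> simp [locOf] at h1 ⊢ <;> omega]
    · rw [hnew, show locOf j (i, b) = (1, false) by
        cases b <;> simp [locOf] at h2 ⊢ <;> omega]
    · rw [hnew, show locOf j (i, b) = (0, true) by
        cases b <;> simp [locOf] at h3 ⊢ <;> omega]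
    · rw [hnew, show locOf j (i, b) = (0, false) by
        cases b <;> simp [locOf] at h4 ⊢ <;> omega]
    · exfalso; omega
  · simp only [InBlock, not_and_or, not_le, not_lt] at hin
    rw [if_neg (show ¬ (2 * (i : ℕ) + b.toNat = 2 * j + 3) by omega),
      if_neg (show ¬ (2 * (i : ℕ) + b.toNat = 2 * j + 2) by omega),
      if_neg (show ¬ (2 * (i : ℕ) + b.toNat = 2 * j + 1) by omega),
      if_neg (show ¬ (2 * (i : ℕ) + b.toNat = 2 * j) by omega), if_neg, h.2 i b]
    simp only [InBlock, not_and_or, not_le, not_lt]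
    exact hin

/-- **The initial rows**: the unit vector of the Majorana `(0, b)` laid out. [folklore] -/
def unitL [Zero K] [One K] (N : ℕ) (b : Bool) : List K := (List.replicate (2 * N) 0).set b.toNat 1

/-- `unitL` lays out `e_{(0,b)}`. [folklore] -/
theorem represents_unitL [Zero K] [One K] (hN : 0 < N) (b : Bool) :
    Represents (unitL N b : List K) (Pi.single ((⟨0, hN⟩ : Fin N), b) 1) := by
  have hb : b.toNat ≤ 1 := Bool.toNat_le b
  refine ⟨by simp [unitL], fun i b' => ?_⟩
  rw [unitL, getD_set_eq _ _ _ (by simp; omega)]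
  have hrep : (List.replicate (2 * N) (0 : K)).getD (2 * (i : ℕ) + b'.toNat) 0 = 0 := by
    rw [List.getD_eq_getElem?_getD, List.getElem?_replicate]; split_ifs <;> rfl
  rw [hrep]
  by_cases h : ((⟨0, hN⟩ : Fin N), b) = (i, b')
  · obtain ⟨rfl, rfl⟩ := Prod.mk.inj h
    rw [Pi.single_eq_same, if_pos (show 2 * ((⟨0, hN⟩ : Fin N) : ℕ) + b.toNat = b.toNat by simp)]
  · rw [Pi.single_eq_of_ne (Ne.symm h), if_neg]
    intro hk
    apply h
    have hb' : b'.toNat ≤ 1 := Bool.toNat_le b'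
    have hi : (i : ℕ) = 0 := by omega
    have hbb : b.toNat = b'.toNat := by omega
    refine Prod.ext (Fin.ext hi.symm) ?_
    cases b <;> cases b' <;> simp_all

/-- **The list fold** of the machine: the list steps applied from the last to the first. [cite: JozsaMiyake2008, §4 eq. (8)] -/
def foldL [NonAssocSemiring K] (ts : List (ℕ × Matrix LIdx LIdx K)) (l : List K) : List K :=
  ts.foldr (fun t acc => stepL t.1 t.2 acc) l

/-- **The rational row fold** on vectors. [cite: JozsaMiyake2008, §4 eq. (8)] -/
def qFold [NonAssocSemiring K] (v : MIdx N → K) (ts : List (ℕ × Matrix LIdx LIdx K)) : MIdx N → K :=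
  ts.foldr (fun t w => w ᵥ* embE t.1 t.2) v

/-- The list fold lays out the vector fold. [cite: JozsaMiyake2008, §4 eq. (8)] -/
theorem Represents.foldL [NonAssocSemiring K] {l : List K} {v : MIdx N → K} (h : Represents l v)
    {ts : List (ℕ × Matrix LIdx LIdx K)} (hts : ∀ t ∈ ts, t.1 + 2 ≤ N) : Represents (foldL ts l) (qFold v ts) := by
  induction ts with
  | nil => exact h
  | cons t ts ih =>
    exact (ih fun t' ht' => hts t' (List.mem_cons_of_mem t ht')).stepL (hts t List.mem_cons_self) t.2

/-- `embE` commutes with entrywise ring maps. [folklore] -/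
theorem embE_map {L : Type*} [NonAssocSemiring K] [NonAssocSemiring L] (f : K →+* L) (j : ℕ) (R : Matrix LIdx LIdx K) :
    (embE j R : Matrix (MIdx N) (MIdx N) K).map f = embE j (R.map f) := by
  ext p q
  simp only [map_apply, embE, of_apply]
  split_ifs <;> simp

/-- **Casting the rational fold to the reals gives the approximate real fold** (whatever exact
blocks are attached). [folklore] -/
theorem cast_qFold (v : MIdx N → ℚ) (ts : List (ℕ × Matrix LIdx LIdx ℚ)) (us : List AStep)
    (hus : us.map (fun u => (u.1, u.2.2)) = ts.map (fun t => (t.1, t.2.map (Rat.cast : ℚ → ℝ)))) :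
    (fun q => ((qFold v ts q : ℚ) : ℝ)) = approxFold (fun q => (v q : ℝ)) us := by
  induction ts generalizing us with
  | nil =>
    cases us with
    | nil => rfl
    | cons u us => simp at hus
  | cons t ts ih =>
    cases us with
    | nil => simp at hus
    | cons u us =>
      simp only [List.map_cons, List.cons.injEq, Prod.mk.injEq] at hus
      obtain ⟨⟨h1, h2⟩, h3⟩ := hus
      rw [approxFold_cons, ← ih us h3, h1, h2]
      funext q
      show (Rat.castHom ℝ) ((qFold v ts ᵥ* embE t.1 t.2) q) = _
      rw [RingHom.map_vecMul, embE_map, Rat.coe_castHom]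
      rfl

/-- **The list read-out** `∑_{i<N} (-1)^{x_i} (l₀[2i] l₁[2i+1] - l₀[2i+1] l₁[2i])`. [cite: JozsaMiyake2008, §4 eq. (10)] -/
def zTerm [Ring K] (bits : List Bool) (l₀ l₁ : List K) (i : ℕ) : K :=
  (if bits.getD i false then -1 else 1) *
    (l₀.getD (2 * i) 0 * l₁.getD (2 * i + 1) 0 - l₀.getD (2 * i + 1) 0 * l₁.getD (2 * i) 0)

/-- The list read-out as a list sum (the form the machine computes). [cite: JozsaMiyake2008, §4 eq. (10)] -/
def zExpL [Ring K] (bits : List Bool) (l₀ l₁ : List K) (N : ℕ) : K := ((List.range N).map (zTerm bits l₀ l₁)).sum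

/-- List sums over `range` are `Finset.range` sums. [folklore] -/
theorem sum_map_range {M : Type*} [AddCommMonoid M] (f : ℕ → M) (n : ℕ) :
    ((List.range n).map f).sum = ∑ i ∈ Finset.range n, f i := by
  induction n with
  | zero => simp
  | succ n ih => rw [List.range_succ, List.map_append, List.sum_append, ih, Finset.sum_range_succ]; simp

/-- **The list read-out lays out `zExp`.** [cite: JozsaMiyake2008, §4 eq. (10)] -/
theorem zExpL_eq_zExp {l₀ l₁ : List ℚ} {v₀ v₁ : MIdx N → ℚ} (h₀ : Represents l₀ v₀) (h₁ : Represents l₁ v₁)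
    (bits : List Bool) (x : QReg N) (hx : ∀ i : Fin N, x i = bits.getD i false) :
    ((zExpL bits l₀ l₁ N : ℚ) : ℝ) = zExp x (fun q => (v₀ q : ℝ)) (fun q => (v₁ q : ℝ)) := by
  rw [zExpL, sum_map_range, Finset.sum_range, zExp]
  push_cast
  refine sum_congr rfl fun i _ => ?_
  have a0 := h₀.2 i false; have a1 := h₀.2 i true; have b0 := h₁.2 i false; have b1 := h₁.2 i true
  simp only [Bool.toNat_false, add_zero, Bool.toNat_true] at a0 a1 b0 b1
  rw [zTerm, a0, a1, b0, b1, ← hx i]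
  push_cast
  split_ifs <;> simp

end layout

end Literature.Computability.QuantumComplexity.Matchgate
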